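import Summits.QuantumFields.YangMills.Theorems.BalabanUVNodesN21GibbsBlockSupHazard
import Summits.QuantumFields.YangMills.Theorems.BalabanUVNodesN21ShellFractionLargeFieldOdds

/-!
# N21 (NE7c) · COLLAR ODDS: the left shell of a `≥`-cut (large-field letter) is carried by its own exceedance — the
# conditional form of part 11 over parts 7–9 (lens Card 71 ∕ ROW C — where roads I and II meet)

R134 seat pub-ymgap-dag-n21-d (g8), node N21 = NE7c (single-run shell-weight bound, NOT PRINTED in [Bałaban 1983–89],
NOT proved), lane K3⁷ `SpineGivenEndpointR13SepCoPH` (stmt-QuantumFields-20544, `--kind proof --supports … --as helper`).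
Part 21 of the comparison series; consumes part 9 (`…N21GibbsBlockSupHazard`) and part 11
(`…N21ShellFractionLargeFieldOdds`), both landed.

WHAT THIS FILE IS.  Lens `ym-lens-BalabanUVNodes-nearmiss` v24.0 Card 71 ∕ ROW C: after the dilation device (parts
16, 18–20) the ONE place road I (the histories ∕ resampling tower of n21-e) still needs road II is the COLLAR block of
a sent (large-field) component: its own cut is a `≥`-cut `{u″ ≥ θ″}`, the inward dilation can EXIT it, and the exit
lands in the LEFT shell `[(1−τ)θ″ − τc₀, θ″)` of the large-field statistic, whose mass must be charged against the
support `{u″ ≥ θ″} ∩ rest` with BOUNDED odds `Q₀`.  Because a `≥`-cut leaves ROOM TO THE RIGHT, the RIGHTWARD hazard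
device applies, and the arithmetic of part 11 turns it into odds — conditionally on any event of the other variables:
* §1 `measure_shell_inter_le_odds_of_condHazard`: for ANY finite measure `ν`, variable `u`, measurable event `C`:
  `ν({a ≤ u < b} ∩ C) ≤ c·ν({a ≤ u} ∩ C)` with `c < 1` ⇒ `ν({a ≤ u < b} ∩ C) ≤ c∕(1−c) · ν({b ≤ u} ∩ C)`
  (part 11's `measure_shell_le_of_hazard` on `ν|C`).
* §2 `collarOdds_of_partialSlope`: Gibbs coordinates `ν = e^{−A} dx` on `ℝ^ι`, one-sided partial slope `≤ Λ` along
  `x_p` on the right `Λ⁻¹`-neighbourhoods of the shell (part 9 `measure_coordSlice_le_of_partialSlope`), any sub-level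
  event of the other coordinates: `ν({a ≤ x_p < b} ∩ C) ≤ Q₀ · ν({b ≤ x_p} ∩ C)`, `Q₀ = c∕(1−c)`, `c = e·Λ·(b − a) < 1`
  — for the collar `b − a = τ(θ″ + c₀)`, `τ = 1∕(d+1)`: `c = e·Λ″·(θ″+c₀)∕(d+1)`, bounded (indeed small) as soon as
  `Λ″θ″ ≲ d`.  Road I's counting (n21-e 38f) then charges `log(1 + Q₀)` per collar block against `p₀`.

HONEST FRAMING.  [textbook] measure arithmetic over parts 9 and 11 (cited by name); 0 def, 0 sorry; the slope bound
`Λ″` for the collar block's fibre law and the sub-level structure of «rest» are HYPOTHESES; nothing of Bałaban's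
asserted; NE7c NOT PRINTED ∕ NOT proved; N21 NOT discharged; counts unmoved (typed 28∕28 · discharged 5∕27);
count-neutral; one finite 𝕋⁴ at fixed ε — nothing about ℝ⁴ ∕ OS ∕ mass gap ∕ Clay.
-/

open MeasureTheory Set Function
open scoped ENNReal NNReal

namespace Summit.QuantumFields.YangMills.Theorems.N21CollarOdds

open Summit.QuantumFields.YangMills.Theorems.N21ShellFractionLargeFieldOdds (measure_shell_le_of_hazard)
open Summit.QuantumFields.YangMills.Theorems.N21GibbsBlockSupHazard (measure_coordSlice_le_of_partialSlope)

/-! ## §1 The conditional odds form -/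

section Cond

variable {Ω : Type*} [MeasurableSpace Ω] (ν : Measure Ω) [IsFiniteMeasure ν] {u : Ω → ℝ}

/-- **CONDITIONAL HAZARD ⇒ CONDITIONAL ODDS.**  For a finite measure, a measurable `u`, ANY event `C` and
`0 ≤ c < 1`: `ν({a ≤ u < b} ∩ C) ≤ c·ν({a ≤ u} ∩ C)` ⇒ `ν({a ≤ u < b} ∩ C) ≤ c∕(1−c) · ν({b ≤ u} ∩ C)` — the
shell conditioned on `C` is carried by the conditioned exceedance of `b` (part 11 on `ν|C`). [textbook] -/
theorem measure_shell_inter_le_odds_of_condHazard (hu : Measurable u) (C : Set Ω)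
    {a b c : ℝ} (hc0 : 0 ≤ c) (hc1 : c < 1)
    (h : ν ({x | a ≤ u x ∧ u x < b} ∩ C) ≤ ENNReal.ofReal c * ν ({x | a ≤ u x} ∩ C)) :
    ν ({x | a ≤ u x ∧ u x < b} ∩ C) ≤ ENNReal.ofReal (c / (1 - c)) * ν ({x | b ≤ u x} ∩ C) := by
  have hS : MeasurableSet {x | a ≤ u x ∧ u x < b} :=
    (measurableSet_le measurable_const hu).inter (measurableSet_lt hu measurable_const)
  have hE : MeasurableSet {x | a ≤ u x} := measurableSet_le measurable_const hu
  have hL : MeasurableSet {x | b ≤ u x} := measurableSet_le measurable_const hu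
  have h' : (ν.restrict C) {x | a ≤ u x ∧ u x < b} ≤ ENNReal.ofReal c * (ν.restrict C) {x | a ≤ u x} := by
    rwa [Measure.restrict_apply hS, Measure.restrict_apply hE]
  have hres := measure_shell_le_of_hazard (ν.restrict C) u hc0 hc1 h'
  rwa [Measure.restrict_apply hS, Measure.restrict_apply hL] at hres

end Cond

/-! ## §2 The collar instance in Gibbs coordinates -/

section Collar

variable {ι : Type*} [Fintype ι] [DecidableEq ι]

/-- **COLLAR ODDS FROM A ONE-SIDED PARTIAL SLOPE** (lens Card 71's `Q₀`).  `ν = e^{−A} dx` on `ℝ^ι` with `e^{−A}`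
integrable; along `x_p` the action has one-sided slope `≤ Λ` (`Λ > 0`) on the right `Λ⁻¹`-neighbourhoods of
`[a, b)`; `C = {x_q < t_q, q ≠ p}` any sub-level event of the other coordinates; `c := e·Λ·(b − a) < 1`.  Then
`ν({a ≤ x_p < b} ∩ C) ≤ c∕(1−c) · ν({b ≤ x_p} ∩ C)` — the left shell below a `≥`-cut at `b` is carried by the cut's
own support, conditionally on the rest. [textbook] -/
theorem collarOdds_of_partialSlope {A : (ι → ℝ) → ℝ} (hA : Measurable A)
    [IsFiniteMeasure ((Measure.pi fun _ : ι => (volume : Measure ℝ)).withDensity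
      fun x => ENNReal.ofReal (Real.exp (-A x)))]
    (p : ι) {a b Λ : ℝ} (hΛ : 0 < Λ) (hab : a ≤ b) (hc1 : Real.exp 1 * Λ * (b - a) < 1)
    (hslope : ∀ x : ι → ℝ, ∀ y₁ ∈ Ico a b, ∀ y₂ ∈ Icc y₁ (y₁ + Λ⁻¹),
      A (update x p y₂) - A (update x p y₁) ≤ Λ * (y₂ - y₁))
    (t : ι → ℝ) :
    (Measure.pi fun _ : ι => (volume : Measure ℝ)).withDensity (fun x => ENNReal.ofReal (Real.exp (-A x)))
        ({x | a ≤ x p ∧ x p < b} ∩ {x | ∀ q, q ≠ p → x q < t q})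
      ≤ ENNReal.ofReal (Real.exp 1 * Λ * (b - a) / (1 - Real.exp 1 * Λ * (b - a))) *
        (Measure.pi fun _ : ι => (volume : Measure ℝ)).withDensity (fun x => ENNReal.ofReal (Real.exp (-A x)))
          ({x | b ≤ x p} ∩ {x | ∀ q, q ≠ p → x q < t q}) := by
  have hc0 : 0 ≤ Real.exp 1 * Λ * (b - a) :=
    mul_nonneg (mul_nonneg (Real.exp_pos 1).le hΛ.le) (sub_nonneg.2 hab)
  exact measure_shell_inter_le_odds_of_condHazard _ (measurable_pi_apply p) _ hc0 hc1
    (measure_coordSlice_le_of_partialSlope hA p hΛ hslope t)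

end Collar

end Summit.QuantumFields.YangMills.Theorems.N21CollarOdds
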